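import Mathlib
import Summits.CriticalPhenomena.PercolationContinuityZ3.Theorems.PercNearOneGluingNoHeavyLowerTailTypedSectioning
import Summits.CriticalPhenomena.PercolationContinuityZ3.Theorems.PercNearOneGluingNoHeavyLowerTailHexMSMatchMS2Instance

/-!
# Typed sectioning with free allocation of single terms; the `F ∪ W` system and its (Π2″)/(MATCH*) bridges (hp-7 gen 82)

Helper file for crux `stmt-CriticalPhenomena-4575` (`NoHeavyLowerTail`, route `PercNearOneGluingNoHeavy`), hull-port seat
`prim-hp-7` (generation 82); `--supports stmt-CriticalPhenomena-4575 --as helper`.  Pure finite set theory; everything is PROVED.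
Memo: `run/shared/lean/prim/prim-hp-7/FROM-prim-hp-7-g82-GENERAL-ALLOCATION.md`.

Gen 81 (`…LowerTailTypedSectioning`) isolated the Ahlswede–Daykin sectioning step for menu systems with one FIXED allocation of the
children's menus (`dblMenu`, `projMenu`).  Here the step is stated in its general form.  A *pair system* gives every minuend `S` a set
`A S` of allowed terms (`TypedSectioning.pterms 𝒮 A = ⋃_{S ∈ 𝒮} A S`).  Sectioning at `r`: the doubled child `dbl 𝒮 r` and the projected
child `proj 𝒮 r` may be given ANY allowed-term functions `A₁`, `A₂` whose terms are `r`-free erasures of terms of the system, subject to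
ONE coupling condition: a term used by both children must be *doubled* (`E` and `insert r E` both terms of the system).  Then the terms
of the children inject disjointly into the terms of the system (`card_add_card_le_card_of_glue`), so a tree of such steps with trivial
leaves (`TypedSectioning.PCert`) proves `#𝒮 ≤ #(pterms 𝒮 A)` (`card_le_card_pterms_of_pcert`).  In particular the `r`-free *single* terms
(exactly one of `E`, `insert r E` a term) may be distributed between the two children arbitrarily — the gen-81 certificates are the
special case 'all singles to the projected child' (`PCert.of_cert`).

Why it is here.  For a depth-one configuration with dead blocks `P` (label `i`), `Q` (label `i+1`) and blockers `W` (label `i+5`) the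
`F ∪ W` system (`fwA`: `p ↦ p \ (P ∪ Q ∪ W)`, `q ↦ q \ (P ∪ Q) ∪ q ∩ W`, `w ↦ w \ P ∪ w ∩ Q` — close labels, alive–alive pairs removed) has
its terms inside `scTerms P Q W`; a certificate with complement-free terms gives (Π2″) (`two_mul_card_le_card_clU_scTerms_of_pcert`) and
Hall's condition for the dead set of the configuration (`card_le_card_farNbhd_of_pcert`).  With free allocation this ONE block transversal
is certified on every derived configuration of the programme's corpora, including the hybrid-only `#F = 8` type on which every fixed
allocation fails (exhaustive `2^[5]`: 6 430 two-type + 24 730 one-type instances; zoo 112, residue 1 200, annealer states `n ≤ 9` 384,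
`#F = 8` type 360; complement coincidences: none).  The uniform theorem (which `r`, which allocation) is open; this file is its vehicle.
-/

namespace Summit.CriticalPhenomena.PercolationContinuityZ3.Theorems

namespace TypedSectioning

open Finset

variable {α : Type*} [DecidableEq α]

/-- The terms of a pair system: minuend `S` may be paid by any member of `A S`. -/
def pterms (𝒮 : Finset (Finset α)) (A : Finset α → Finset (Finset α)) : Finset (Finset α) :=
  𝒮.biUnion A

/-- Membership in `pterms`. -/
theorem mem_pterms {𝒮 : Finset (Finset α)} {A : Finset α → Finset (Finset α)} {E : Finset α} :
    E ∈ pterms 𝒮 A ↔ ∃ S ∈ 𝒮, E ∈ A S := by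
  unfold pterms; rw [mem_biUnion]

/-- The menu system `M` is the pair system `S ↦ {S \ T : T ∈ M S}`, with the same terms. -/
theorem pterms_eq_terms (𝒮 : Finset (Finset α)) (M : Finset α → Finset (Finset α)) :
    pterms 𝒮 (fun S => (M S).image fun T => S \ T) = terms 𝒮 M := rfl

/-- **General sectioning certificates** (hp-7 gen 82).  The empty system and `{∅}` with `∅ ∈ A ∅` are certified; a system is certified
if for some element `r` its doubled and projected children carry allowed-term functions `A₁`, `A₂` such that (i) every child term is
`r`-free and it or its union with `r` is a term of the system, (ii) a term common to both children is doubled in the system, and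
(iii) both children are certified. -/
inductive PCert : Finset (Finset α) → (Finset α → Finset (Finset α)) → Prop
  | empty (A : Finset α → Finset (Finset α)) : PCert ∅ A
  | leaf (A : Finset α → Finset (Finset α)) (h : (∅ : Finset α) ∈ A ∅) : PCert {∅} A
  | step (𝒮 : Finset (Finset α)) (A : Finset α → Finset (Finset α)) (r : α) (A₁ A₂ : Finset α → Finset (Finset α))
      (h₁ : ∀ X ∈ dbl 𝒮 r, ∀ E ∈ A₁ X, r ∉ E ∧ (E ∈ pterms 𝒮 A ∨ insert r E ∈ pterms 𝒮 A))
      (h₂ : ∀ S ∈ proj 𝒮 r, ∀ E ∈ A₂ S, r ∉ E ∧ (E ∈ pterms 𝒮 A ∨ insert r E ∈ pterms 𝒮 A))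
      (hc : ∀ E ∈ pterms (dbl 𝒮 r) A₁, E ∈ pterms (proj 𝒮 r) A₂ → E ∈ pterms 𝒮 A ∧ insert r E ∈ pterms 𝒮 A)
      (c₁ : PCert (dbl 𝒮 r) A₁) (c₂ : PCert (proj 𝒮 r) A₂) : PCert 𝒮 A

/-- **The general gluing step.**  Two families `T₁`, `T₂` of `r`-free sets, each member of which is a term or becomes one after
inserting `r`, and whose common members are doubled terms, satisfy `#T₁ + #T₂ ≤ #T`: send an exclusive member `E` to whichever of
`E`, `insert r E` is a term (preferring `E`), and a common member to `insert r E` (first copy) and `E` (second copy). -/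
theorem card_add_card_le_card_of_glue (T T₁ T₂ : Finset (Finset α)) (r : α)
    (h₁ : ∀ E ∈ T₁, r ∉ E ∧ (E ∈ T ∨ insert r E ∈ T)) (h₂ : ∀ E ∈ T₂, r ∉ E ∧ (E ∈ T ∨ insert r E ∈ T))
    (hc : ∀ E ∈ T₁, E ∈ T₂ → E ∈ T ∧ insert r E ∈ T) : #T₁ + #T₂ ≤ #T := by
  classical
  let φ : Finset α → Finset α := fun E => if E ∈ T then E else insert r E
  have hfree : ∀ E ∈ T₁ ∪ T₂, r ∉ E ∧ (E ∈ T ∨ insert r E ∈ T) := by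
    intro E hE
    rcases mem_union.mp hE with h | h
    · exact h₁ E h
    · exact h₂ E h
  have hφerase : ∀ E ∈ T₁ ∪ T₂, (φ E).erase r = E := by
    intro E hE
    have hrE := (hfree E hE).1
    by_cases h : E ∈ T
    · simp only [φ, if_pos h]; exact erase_eq_of_notMem hrE
    · simp only [φ, if_neg h]; exact erase_insert hrE
  have hA : (T₁ ∪ T₂).image φ ⊆ T := by
    intro x hx
    obtain ⟨E, hE, rfl⟩ := mem_image.mp hx
    by_cases h : E ∈ T
    · simp only [φ, if_pos h]; exact h
    · simp only [φ, if_neg h]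
      exact ((hfree E hE).2.resolve_left h)
  have hB : (T₁ ∩ T₂).image (fun E => insert r E) ⊆ T := by
    intro x hx
    obtain ⟨E, hE, rfl⟩ := mem_image.mp hx
    exact (hc E (mem_inter.mp hE).1 (mem_inter.mp hE).2).2
  have hinjA : Set.InjOn φ ((T₁ ∪ T₂ : Finset (Finset α)) : Set (Finset α)) := by
    intro E hE E' hE' h
    rw [← hφerase E (mem_coe.mp hE), ← hφerase E' (mem_coe.mp hE')]
    exact congrArg (fun F => F.erase r) h
  have hinjB : Set.InjOn (fun E => insert r E) ((T₁ ∩ T₂ : Finset (Finset α)) : Set (Finset α)) := by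
    intro E hE E' hE' h
    have hrE : r ∉ E := (hfree E (mem_union_left _ (mem_inter.mp (mem_coe.mp hE)).1)).1
    have hrE' : r ∉ E' := (hfree E' (mem_union_left _ (mem_inter.mp (mem_coe.mp hE')).1)).1
    have h' : insert r E = insert r E' := h
    rw [← erase_insert hrE, h', erase_insert hrE']
  have hdisj : Disjoint ((T₁ ∪ T₂).image φ) ((T₁ ∩ T₂).image fun E => insert r E) := by
    rw [Finset.disjoint_left]
    intro x hx hx'
    obtain ⟨E, hE, rfl⟩ := mem_image.mp hx
    obtain ⟨E', hE', hEq⟩ := mem_image.mp hx'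
    by_cases h : E ∈ T
    · simp only [φ, if_pos h] at hEq
      have hrE := (hfree E hE).1
      rw [← hEq] at hrE
      exact hrE (mem_insert_self r E')
    · simp only [φ, if_neg h] at hEq
      have hrE := (hfree E hE).1
      have hrE' : r ∉ E' := (hfree E' (mem_union_left _ (mem_inter.mp hE').1)).1
      have : E' = E := by rw [← erase_insert hrE', hEq, erase_insert hrE]
      rw [this] at hE'
      exact h (hc E (mem_inter.mp hE').1 (mem_inter.mp hE').2).1
  calc #T₁ + #T₂ = #(T₁ ∪ T₂) + #(T₁ ∩ T₂) := (card_union_add_card_inter T₁ T₂).symm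
    _ = #((T₁ ∪ T₂).image φ) + #((T₁ ∩ T₂).image fun E => insert r E) := by
          rw [card_image_of_injOn hinjA, card_image_of_injOn hinjB]
    _ = #((T₁ ∪ T₂).image φ ∪ (T₁ ∩ T₂).image fun E => insert r E) := (card_union_of_disjoint hdisj).symm
    _ ≤ #T := card_le_card (union_subset hA hB)

/-- **A certified pair system has at least as many terms as minuends** (hp-7 gen 82: sectioning with free allocation of single terms). -/
theorem card_le_card_pterms_of_pcert {𝒮 : Finset (Finset α)} {A : Finset α → Finset (Finset α)} (h : PCert 𝒮 A) :
    #𝒮 ≤ #(pterms 𝒮 A) := by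
  induction h with
  | empty A => simp
  | leaf A h =>
    rw [card_singleton]
    exact card_pos.mpr ⟨∅, mem_pterms.mpr ⟨∅, mem_singleton_self _, h⟩⟩
  | step 𝒮 A r A₁ A₂ h₁ h₂ hc c₁ c₂ ih₁ ih₂ =>
    rw [card_eq_card_dbl_add_card_proj 𝒮 r]
    refine (Nat.add_le_add ih₁ ih₂).trans (card_add_card_le_card_of_glue _ _ _ r ?_ ?_ hc)
    · intro E hE
      obtain ⟨X, hX, hEX⟩ := mem_pterms.mp hE
      exact h₁ X hX E hEX
    · intro E hE
      obtain ⟨S, hS, hES⟩ := mem_pterms.mp hE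
      exact h₂ S hS E hES

/-- A certified pair system whose terms lie in a family `T` has at most `#T` minuends. -/
theorem card_le_card_of_pcert {𝒮 T : Finset (Finset α)} {A : Finset α → Finset (Finset α)} (h : PCert 𝒮 A)
    (hT : pterms 𝒮 A ⊆ T) : #𝒮 ≤ #T :=
  (card_le_card_pterms_of_pcert h).trans (card_le_card hT)

/-- The gen-81 menu certificates are general certificates (the allocation 'all single terms to the projected child'). -/
theorem PCert.of_cert {𝒮 : Finset (Finset α)} {M : Finset α → Finset (Finset α)} (h : Cert 𝒮 M) :
    PCert 𝒮 (fun S => (M S).image fun T => S \ T) := by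
  induction h with
  | empty M => exact PCert.empty _
  | leaf M h => exact PCert.leaf _ (mem_image.mpr ⟨∅, h, sdiff_self⟩)
  | step 𝒮 M r h₁ h₂ ih₁ ih₂ =>
    refine PCert.step 𝒮 _ r (fun S => (dblMenu M r S).image fun T => S \ T)
      (fun S => (projMenu 𝒮 M r S).image fun T => S \ T) ?_ ?_ ?_ ih₁ ih₂
    · intro X hX E hE
      have hE' : E ∈ terms (dbl 𝒮 r) (dblMenu M r) := mem_terms.mpr ⟨X, hX, by simpa only [mem_image] using hE⟩
      have h3 := mem_terms_of_mem_terms_dbl hE'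
      exact ⟨h3.2.2, Or.inl (by rw [pterms_eq_terms]; exact h3.1)⟩
    · intro S hS E hE
      have hE' : E ∈ terms (proj 𝒮 r) (projMenu 𝒮 M r) := mem_terms.mpr ⟨S, hS, by simpa only [mem_image] using hE⟩
      obtain ⟨hrE, D, hD, hDE⟩ := exists_of_mem_terms_proj hE'
      refine ⟨hrE, ?_⟩
      rw [pterms_eq_terms]
      by_cases hrD : r ∈ D
      · right; rw [← hDE, insert_erase hrD]; exact hD
      · left; rw [← hDE, erase_eq_of_notMem hrD]; exact hD
    · intro E hE _
      rw [pterms_eq_terms] at hE ⊢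
      have h3 := mem_terms_of_mem_terms_dbl hE
      exact ⟨h3.1, h3.2.1⟩

end TypedSectioning

/-! ## The `F ∪ W` pair system of a depth-one configuration and the (Π2″) / (MATCH*) bridges -/

namespace TypedSectioning

open Finset GeneratedDonors
open scoped FinsetFamily

variable {α : Type*} [DecidableEq α]

/-- The allowed terms of the `F ∪ W` system of blocks `P`, `Q` and blockers `W` ((Π2″) mode: minuend labels `0, 1, 5`; a minuend
may use its difference with every close-labelled member of `𝒟 = cl(P ∪ Q ∪ W)`, alive–alive pairs removed; `s \ (U \ t) = s ∩ t`):
`p ↦ p \ (P ∪ Q ∪ W)`, `q ↦ q \ (P ∪ Q) ∪ q ∩ W`, `w ↦ w \ P ∪ w ∩ Q`. -/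
def fwA (P Q W : Finset (Finset α)) : Finset α → Finset (Finset α) := fun s =>
  (if s ∈ P then (P ∪ Q ∪ W).image (fun t => s \ t) else ∅) ∪
  ((if s ∈ Q then (P ∪ Q).image (fun t => s \ t) ∪ W.image (fun t => s ∩ t) else ∅) ∪
  (if s ∈ W then P.image (fun t => s \ t) ∪ Q.image (fun t => s ∩ t) else ∅))

/-- Every allowed term of `s` in the `F ∪ W` system is a subset of `s`. -/
theorem subset_of_mem_fwA {P Q W : Finset (Finset α)} {s E : Finset α} (hE : E ∈ fwA P Q W s) : E ⊆ s := by
  unfold fwA at hE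
  simp only [mem_union] at hE
  rcases hE with h | h | h
  · split_ifs at h
    · obtain ⟨t, -, rfl⟩ := mem_image.mp h; exact sdiff_subset
    · exact absurd h (notMem_empty _)
  · split_ifs at h
    · rcases mem_union.mp h with h | h
      · obtain ⟨t, -, rfl⟩ := mem_image.mp h; exact sdiff_subset
      · obtain ⟨t, -, rfl⟩ := mem_image.mp h; exact inter_subset_left
    · exact absurd h (notMem_empty _)
  · split_ifs at h
    · rcases mem_union.mp h with h | h
      · obtain ⟨t, -, rfl⟩ := mem_image.mp h; exact sdiff_subset
      · obtain ⟨t, -, rfl⟩ := mem_image.mp h; exact inter_subset_left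
    · exact absurd h (notMem_empty _)

/-- **The terms of the `F ∪ W` system lie in the (Π2″) term family** `scTerms P Q W` (in fact in its seven families other than `Q ⊻ W`). -/
theorem pterms_fwA_subset_scTerms (P Q W : Finset (Finset α)) :
    pterms (P ∪ Q ∪ W) (fwA P Q W) ⊆ scTerms P Q W := by
  intro E hE
  obtain ⟨s, -, hEs⟩ := mem_pterms.mp hE
  unfold scTerms
  simp only [mem_union]
  unfold fwA at hEs
  simp only [mem_union] at hEs
  rcases hEs with h | h | h
  · split_ifs at h with hs
    · obtain ⟨t, ht, rfl⟩ := mem_image.mp h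
      simp only [mem_union] at ht
      rcases ht with (ht | ht) | ht
      · exact Or.inl (Or.inl (Or.inl (Or.inl (Or.inl (Or.inl (Or.inl (mem_diffs.mpr ⟨s, hs, t, ht, rfl⟩)))))))
      · exact Or.inl (Or.inl (Or.inl (Or.inl (Or.inl (Or.inr (mem_diffs.mpr ⟨s, hs, t, ht, rfl⟩))))))
      · exact Or.inl (Or.inl (Or.inl (Or.inr (mem_diffs.mpr ⟨s, hs, t, ht, rfl⟩))))
    · exact absurd h (notMem_empty _)
  · split_ifs at h with hs
    · rcases mem_union.mp h with h | h
      · obtain ⟨t, ht, rfl⟩ := mem_image.mp h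
        rcases mem_union.mp ht with ht | ht
        · exact Or.inl (Or.inl (Or.inl (Or.inl (Or.inr (mem_diffs.mpr ⟨s, hs, t, ht, rfl⟩)))))
        · exact Or.inl (Or.inl (Or.inl (Or.inl (Or.inl (Or.inl (Or.inr (mem_diffs.mpr ⟨s, hs, t, ht, rfl⟩)))))))
      · obtain ⟨t, ht, rfl⟩ := mem_image.mp h
        exact Or.inl (Or.inr (mem_infs.mpr ⟨s, hs, t, ht, rfl⟩))
    · exact absurd h (notMem_empty _)
  · split_ifs at h with hs
    · rcases mem_union.mp h with h | h
      · obtain ⟨t, ht, rfl⟩ := mem_image.mp h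
        exact Or.inl (Or.inl (Or.inr (mem_diffs.mpr ⟨s, hs, t, ht, rfl⟩)))
      · obtain ⟨t, ht, rfl⟩ := mem_image.mp h
        exact Or.inl (Or.inr (mem_infs.mpr ⟨t, ht, s, hs, inter_comm t s⟩))
    · exact absurd h (notMem_empty _)

variable {U : Finset α}

/-- **(Π2″) from a certificate of the `F ∪ W` system** (hp-7 gen 82): if the blocks `P`, `Q` and the blockers `W` are pairwise
disjoint families of subsets of `U`, the `F ∪ W` pair system is certified, and no term is the complement of a term, then
`2 (#P + #Q + #W) ≤ #clU U (scTerms P Q W)`.  No structural hypothesis on `P, Q, W` is needed at this point. -/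
theorem two_mul_card_le_card_clU_scTerms_of_pcert (P Q W : Finset (Finset α))
    (hU : ∀ a ∈ P ∪ Q ∪ W, a ⊆ U) (hPQ : Disjoint P Q) (hFW : Disjoint (P ∪ Q) W)
    (hcert : PCert (P ∪ Q ∪ W) (fwA P Q W))
    (hcc : ∀ t ∈ pterms (P ∪ Q ∪ W) (fwA P Q W), U \ t ∉ pterms (P ∪ Q ∪ W) (fwA P Q W)) :
    2 * (#P + #Q + #W) ≤ #(clU U (scTerms P Q W)) := by
  classical
  set T := pterms (P ∪ Q ∪ W) (fwA P Q W) with hTdef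
  have hTU : ∀ t ∈ T, t ⊆ U := by
    intro t ht
    obtain ⟨s, hs, hts⟩ := mem_pterms.mp ht
    exact (subset_of_mem_fwA hts).trans (hU s hs)
  have hcard : #(P ∪ Q ∪ W) = #P + #Q + #W := by
    rw [card_union_of_disjoint hFW, card_union_of_disjoint hPQ]
  have h1 : #P + #Q + #W ≤ #T := hcard ▸ card_le_card_pterms_of_pcert hcert
  have hinj : Set.InjOn (fun t : Finset α => U \ t) ↑T := by
    intro t ht t' ht' h
    have h' := congrArg (fun s => U \ s) h
    simp only [Finset.sdiff_sdiff_eq_self (hTU t (mem_coe.mp ht)), Finset.sdiff_sdiff_eq_self (hTU t' (mem_coe.mp ht'))] at h'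
    exact h'
  have hdisj : Disjoint T (T.image fun t => U \ t) := by
    rw [Finset.disjoint_left]
    intro t ht ht'
    obtain ⟨t', ht'', rfl⟩ := mem_image.mp ht'
    exact hcc t' ht'' ht
  have h2 : #(clU U T) = 2 * #T := by
    unfold clU
    rw [card_union_of_disjoint hdisj, card_image_of_injOn hinj]; ring
  have h3 : clU U T ⊆ clU U (scTerms P Q W) := by
    intro t ht
    rcases mem_clU.mp ht with h | ⟨u, hu, rfl⟩
    · exact mem_clU.mpr (Or.inl (pterms_fwA_subset_scTerms P Q W h))
    · exact mem_clU.mpr (Or.inr ⟨u, pterms_fwA_subset_scTerms P Q W hu, rfl⟩)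
  calc 2 * (#P + #Q + #W) ≤ 2 * #T := Nat.mul_le_mul_left 2 h1
    _ = #(clU U T) := h2.symm
    _ ≤ #(clU U (scTerms P Q W)) := card_le_card h3

section DepthOne

variable {𝒟 : Finset (Finset α)} {x : Finset α → ZMod 6}

/-- **(MATCH*) from a certificate of the `F ∪ W` system** (hp-7 gen 82).  For an antipodal instance whose dead members carry labels in
`{i, i+1, i+3, i+4}` and whose alive members carry labels in `{i+5, i+2}` (depth one), let `P`, `Q` be the dead classes of labels `i`,
`i+1` and `W` the alive class of label `i+5`.  If the `F ∪ W` pair system is certified and none of its terms is the complement of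
another, Hall's condition holds for the dead set: `#𝒟 ≤ #(farNbhd 𝒟 x (dead U 𝒟 x))`.  (The terms are far products with a dead factor,
`clU_scTerms_subset_farNbhd`.) -/
theorem card_le_card_farNbhd_of_pcert (hU : ∀ a ∈ 𝒟, a ⊆ U) (hco : ∀ a ∈ 𝒟, U \ a ∈ 𝒟)
    (hanti : ∀ a ∈ 𝒟, x (U \ a) = x a + 3) (i : ZMod 6)
    (hlab : ∀ a ∈ dead U 𝒟 x, x a = i ∨ x a = i + 1 ∨ x a = i + 3 ∨ x a = i + 4)
    (halive : ∀ d ∈ 𝒟, d ∉ dead U 𝒟 x → x d = i + 5 ∨ x d = i + 2)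
    (P Q W : Finset (Finset α)) (hPdef : P = (dead U 𝒟 x).filter fun a => x a = i)
    (hQdef : Q = (dead U 𝒟 x).filter fun a => x a = i + 1) (hWdef : W = (𝒟 \ dead U 𝒟 x).filter fun a => x a = i + 5)
    (hcert : PCert (P ∪ Q ∪ W) (fwA P Q W))
    (hcc : ∀ t ∈ pterms (P ∪ Q ∪ W) (fwA P Q W), U \ t ∉ pterms (P ∪ Q ∪ W) (fwA P Q W)) :
    #𝒟 ≤ #(farNbhd 𝒟 x (dead U 𝒟 x)) := by
  classical
  obtain ⟨n01, n30, n31, n40, n41, n85, n50, n51, n20, n21, n25, n53, n54, e33, e43, e23⟩ := label_facts i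
  have hP : ∀ p ∈ P, p ∈ dead U 𝒟 x ∧ x p = i := fun p hp => by
    rw [hPdef] at hp; have h := mem_filter.mp hp; exact ⟨h.1, h.2⟩
  have hQ : ∀ q ∈ Q, q ∈ dead U 𝒟 x ∧ x q = i + 1 := fun q hq => by
    rw [hQdef] at hq; have h := mem_filter.mp hq; exact ⟨h.1, h.2⟩
  have hW : ∀ w ∈ W, (w ∈ 𝒟 ∧ w ∉ dead U 𝒟 x) ∧ x w = i + 5 := fun w hw => by
    rw [hWdef] at hw; have h := mem_filter.mp hw; exact ⟨mem_sdiff.mp h.1, h.2⟩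
  have hdD : ∀ {a}, a ∈ dead U 𝒟 x → a ∈ 𝒟 := fun ha => (mem_filter.mp ha).1
  have hcc' : ∀ {a}, a ⊆ U → U \ (U \ a) = a := fun ha => Finset.sdiff_sdiff_eq_self ha
  -- the hypotheses of the pure inequality
  have h1 : ∀ a ∈ P ∪ Q ∪ W, a ⊆ U := by
    intro a ha
    simp only [mem_union] at ha
    rcases ha with (ha | ha) | ha
    · exact hU a (hdD (hP a ha).1)
    · exact hU a (hdD (hQ a ha).1)
    · exact hU a (hW a ha).1.1
  have h2 : Disjoint P Q := by
    rw [Finset.disjoint_left]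
    intro a haP haQ
    exact n01 ((hP a haP).2.symm.trans (hQ a haQ).2)
  have h3 : Disjoint (P ∪ Q) W := by
    rw [Finset.disjoint_left]
    intro a haF haW
    rcases mem_union.mp haF with ha | ha
    · exact (hW a haW).1.2 (hP a ha).1
    · exact (hW a haW).1.2 (hQ a ha).1
  have hineq : 2 * (#P + #Q + #W) ≤ #(clU U (scTerms P Q W)) :=
    two_mul_card_le_card_clU_scTerms_of_pcert P Q W h1 h2 h3 hcert hcc
  have hsub : clU U (scTerms P Q W) ⊆ farNbhd 𝒟 x (dead U 𝒟 x) :=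
    clU_scTerms_subset_farNbhd hU hco hanti i hP hQ (fun w hw => ⟨(hW w hw).1.1, (hW w hw).2⟩)
  -- counting 𝒟: every member or its complement lies in P ∪ Q ∪ W
  set A : Finset (Finset α) := 𝒟.filter fun d => x d = i ∨ x d = i + 1 ∨ x d = i + 5 with hAdef
  set B : Finset (Finset α) := 𝒟.filter fun d => ¬ (x d = i ∨ x d = i + 1 ∨ x d = i + 5) with hBdef
  have hmemPQW : ∀ d ∈ 𝒟, (x d = i ∨ x d = i + 1 ∨ x d = i + 5) → d ∈ P ∪ Q ∪ W := by
    intro d hd hx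
    simp only [mem_union]
    by_cases hdead : d ∈ dead U 𝒟 x
    · rcases hx with h | h | h
      · left; left; rw [hPdef]; exact mem_filter.mpr ⟨hdead, h⟩
      · left; right; rw [hQdef]; exact mem_filter.mpr ⟨hdead, h⟩
      · exfalso
        rcases hlab d hdead with h' | h' | h' | h'
        · exact n50 (h.symm.trans h')
        · exact n51 (h.symm.trans h')
        · exact n53 (h.symm.trans h')
        · exact n54 (h.symm.trans h')
    · rcases halive d hd hdead with h5' | h2'
      · right; rw [hWdef]; exact mem_filter.mpr ⟨mem_sdiff.mpr ⟨hd, hdead⟩, h5'⟩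
      · exfalso
        rcases hx with h | h | h
        · exact n20 (h2'.symm.trans h)
        · exact n21 (h2'.symm.trans h)
        · exact n25 (h2'.symm.trans h)
  have hA : A ⊆ P ∪ Q ∪ W := fun d hd => hmemPQW d (mem_filter.mp hd).1 (mem_filter.mp hd).2
  have hB : B.image (fun d => U \ d) ⊆ P ∪ Q ∪ W := by
    intro e he
    obtain ⟨d, hd, rfl⟩ := mem_image.mp he
    obtain ⟨hdD', hnot⟩ := mem_filter.mp hd
    refine hmemPQW (U \ d) (hco d hdD') ?_
    rw [hanti d hdD']
    by_cases hdead : d ∈ dead U 𝒟 x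
    · rcases hlab d hdead with h | h | h | h
      · exact absurd (Or.inl h) hnot
      · exact absurd (Or.inr (Or.inl h)) hnot
      · rw [h]; exact Or.inl e33
      · rw [h]; exact Or.inr (Or.inl e43)
    · rcases halive d hdD' hdead with h5' | h2'
      · exact absurd (Or.inr (Or.inr h5')) hnot
      · rw [h2']; exact Or.inr (Or.inr e23)
  have hinjB : Set.InjOn (fun d : Finset α => U \ d) ↑B := by
    intro d hd e he hde
    have hdU : d ⊆ U := hU d (mem_filter.mp (mem_coe.mp hd)).1
    have heU : e ⊆ U := hU e (mem_filter.mp (mem_coe.mp he)).1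
    have h1' := congrArg (fun t => U \ t) hde
    simp only [hcc' hdU, hcc' heU] at h1'
    exact h1'
  have hsplit : #A + #B = #𝒟 := card_filter_add_card_filter_not _
  have hcardA : #A ≤ #(P ∪ Q ∪ W) := card_le_card hA
  have hcardB : #B ≤ #(P ∪ Q ∪ W) := by
    rw [← card_image_of_injOn hinjB]; exact card_le_card hB
  have hunion : #(P ∪ Q ∪ W) ≤ #P + #Q + #W :=
    (card_union_le _ _).trans (Nat.add_le_add_right (card_union_le _ _) _)
  have hT := card_le_card hsub
  omega

end DepthOne

end TypedSectioning

end Summit.CriticalPhenomena.PercolationContinuityZ3.Theorems
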